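import Literature.NumberTheory.EllipticCurves.PadicSeriesEvaluation
import Literature.NumberTheory.EllipticCurves.KuriharaNumber
import HarnessLib

/-!
# Cube roots of `p`-integral series are `p`-integral for `p ≠ 3` — the companion of (BI) away from `3`
# (route `ManinLocalTwoThree`, crux C3 `ManinPrimeToThreeAtNine` stmt-BirchSwinnertonDyer-22968; cell bsd-f2-manin, prover seat p3 gen 15 —
# toward node (AN♮) `KummerCubeRootCongruenceOfBoundedOfUDC` of -an g37's UDC line, MEMO-an §80.12: «`h^{min} ∈ ℤ[1/3]⟦q⟧`»)

an's (AN) feeds the Unbounded Denominators theorem with `F = D′·ρ⁻¹h·P(j)^e·Δ^k ∈ ℤ⟦q⟧`, which needs the normalised cube root `h` of the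
Kummer series to have BOUNDED DENOMINATORS AT EVERY PRIME: at `p = 3` this is (BI) (`…KummerCubeRootThreeBounded`, p725131, under `3 ∣ c`);
at `p ≠ 3` it is elementary and unconditional — **`isPadicInt_of_pow_three_eq`: if `Θ ∈ ℤ_p⟦X⟧` (`p ≠ 3`), `h³ = Θ` and `‖h(0)‖_p = 1`
then `h ∈ ℤ_p⟦X⟧`** (strong induction on `n`: writing `h = t + r` with `t` the truncation below `n`, `Θₙ = (t³)ₙ + 3h₀²hₙ`, and `3h₀²` is a
`p`-adic unit), with the rational reading `not_dvd_den_coeff_of_pow_three_eq` (`p ∤ den hₙ`).  So the minimal-model cube root `h^{min}`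
(an: `Θ^{min} ∈ −1 + qℤ⟦q⟧` by Honda) lies in `ℤ[1/3]⟦q⟧`.  Pure algebra; nothing about C3, Manin's conjecture or BSD is proved.
[cite: Washington1997, §7.1 (shape: p-adic power series bookkeeping)]
-/

set_option autoImplicit false
-- lint-debt: the directory name repeats the summit name (sibling precedent `ManinLocalTwoThreeKummerCubeRootThreeBounded.lean`)
set_option linter.dupNamespace false

noncomputable section

open scoped Classical
open PowerSeries Finset Literature.NumberTheory.EllipticCurves

namespace Summit.BirchSwinnertonDyer.BirchSwinnertonDyer.Theorems.ManinLocalTwoThree.KummerCubeRootBounded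

variable {p : ℕ} [Fact p.Prime]

/-- If `r` has no terms below degree `n` then `(A·r)ₘ = A₀·rₘ` for `m ≤ n`. [folklore] -/
theorem coeff_mul_of_coeff_lt_eq_zero {K : Type*} [CommRing K] {A r : K⟦X⟧} {n : ℕ} (hr : ∀ i < n, coeff i r = 0) {m : ℕ}
    (hm : m ≤ n) : coeff m (A * r) = constantCoeff A * coeff m r := by
  rw [coeff_mul, Finset.sum_eq_single (0, m)]
  · simp
  · rintro ⟨i, j⟩ hij hne
    have hij' : i + j = m := by simpa using hij
    have hj : j < n := by
      rcases Nat.eq_zero_or_pos i with h0 | hpos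
      · exfalso; apply hne; subst h0; simp_all
      · omega
    rw [hr j hj, mul_zero]
  · intro h; exact absurd (by simp) h

/-- **Cube roots of `p`-integral series are `p`-integral (`p ≠ 3`).**  If `Θ ∈ ℤ_p⟦X⟧`, `h³ = Θ` in `ℚ_p⟦X⟧` and `h(0)` is a `p`-adic
unit then `h ∈ ℤ_p⟦X⟧`: by strong induction, `Θₙ = (t³)ₙ + 3h₀²hₙ` where `t` is the truncation of `h` below `n` (`p`-integral by
induction) and `r = h − t` contributes nothing else in degree `n` (`r², r³, t·r²` vanish there, `(t²r)ₙ = t₀²rₙ`). [folklore] -/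
theorem isPadicInt_of_pow_three_eq (hp3 : p ≠ 3) {Θ h : ℚ_[p]⟦X⟧} (hΘ : IsPadicInt Θ) (hh : h ^ 3 = Θ)
    (hh0 : ‖constantCoeff h‖ = 1) : IsPadicInt h := by
  rw [isPadicInt_iff_coeff]
  intro n
  induction n using Nat.strong_induction_on with
  | _ n ih =>
    rcases Nat.eq_zero_or_pos n with rfl | hn
    · rw [coeff_zero_eq_constantCoeff, hh0]
    -- truncation `t` below `n` and remainder `r`
    set t : ℚ_[p]⟦X⟧ := PowerSeries.mk fun m ↦ if m < n then coeff m h else 0 with ht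
    set r : ℚ_[p]⟦X⟧ := h - t with hrdef
    have hr : ∀ i < n, coeff i r = 0 := fun i hi ↦ by simp [hrdef, ht, coeff_mk, hi]
    have hrn : coeff n r = coeff n h := by simp [hrdef, ht, coeff_mk]
    have ht0 : constantCoeff t = constantCoeff h := by
      rw [← coeff_zero_eq_constantCoeff, ht, coeff_mk, if_pos hn, coeff_zero_eq_constantCoeff]
    have htint : IsPadicInt t := by
      rw [isPadicInt_iff_coeff]; intro m
      rw [ht, coeff_mk]
      split_ifs with hm
      · exact ih m hm
      · simp
    -- degree-`n` coefficients of the pieces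
    have hr2 : ∀ m ≤ n, coeff m (r * r) = 0 := fun m hm ↦ by
      rw [coeff_mul_of_coeff_lt_eq_zero hr hm, ← coeff_zero_eq_constantCoeff, hr 0 hn, zero_mul]
    have hr3 : coeff n (r * r * r) = 0 := by
      rw [coeff_mul_of_coeff_lt_eq_zero hr le_rfl, ← coeff_zero_eq_constantCoeff,
        hr2 0 (Nat.zero_le _), zero_mul]
    have htr2 : coeff n (t * (r * r)) = 0 := by
      rw [coeff_mul_of_coeff_lt_eq_zero (fun i hi ↦ hr2 i hi.le) le_rfl, hr2 n le_rfl, mul_zero]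
    have ht2r : coeff n (t * t * r) = constantCoeff h ^ 2 * coeff n h := by
      rw [coeff_mul_of_coeff_lt_eq_zero hr le_rfl, map_mul, ht0, hrn]; ring
    have hexp : coeff n Θ = coeff n (t ^ 3) + 3 * (constantCoeff h ^ 2 * coeff n h) := by
      have e : Θ = t ^ 3 + 3 * (t * t * r) + 3 * (t * (r * r)) + r * r * r := by
        rw [← hh, show h = t + r by rw [hrdef]; ring]; ring
      rw [e, map_add, map_add, map_add, hr3, add_zero]
      rw [show (3 : ℚ_[p]⟦X⟧) = C (3 : ℚ_[p]) from (map_ofNat C 3).symm, coeff_C_mul, coeff_C_mul, htr2, mul_zero, add_zero,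
        ht2r]
    -- solve for `hₙ`
    have h3 : ‖(3 : ℚ_[p])‖ = 1 := by
      have hcop : p.Coprime 3 := (Nat.coprime_primes (Fact.out : p.Prime) Nat.prime_three).mpr hp3
      have h := (Padic.norm_natCast_eq_one_iff (p := p) (n := 3)).mpr hcop
      exact_mod_cast h
    have hunit : ‖3 * constantCoeff h ^ 2‖ = 1 := by rw [norm_mul, norm_pow, h3, hh0]; norm_num
    have hsolve : coeff n h = (coeff n Θ - coeff n (t ^ 3)) * (3 * constantCoeff h ^ 2)⁻¹ := by
      have hne : (3 : ℚ_[p]) * constantCoeff h ^ 2 ≠ 0 := by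
        intro h0; rw [h0, norm_zero] at hunit; exact zero_ne_one hunit
      rw [eq_mul_inv_iff_mul_eq₀ hne]
      linear_combination -hexp
    rw [hsolve, norm_mul, norm_inv, hunit, inv_one, mul_one]
    have hΘn := (isPadicInt_iff_coeff.mp hΘ) n
    have ht3n := (isPadicInt_iff_coeff.mp (htint.pow 3)) n
    rw [sub_eq_add_neg]
    exact (Padic.nonarchimedean _ _).trans (max_le hΘn (by rwa [norm_neg]))

/-- **Rational reading**: for `Θ ∈ ℚ⟦X⟧` with `p`-integral coefficients (`p ≠ 3`), `h³ = Θ` and `h(0) = −1`, no coefficient of `h`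
has `p` in its denominator. [folklore] -/
theorem not_dvd_den_coeff_of_pow_three_eq (hp3 : p ≠ 3) {Θ h : ℚ⟦X⟧} (hΘ : ∀ n, ¬ p ∣ (coeff n Θ).den) (hh : h ^ 3 = Θ)
    (hh0 : constantCoeff h = -1) (n : ℕ) : ¬ p ∣ (coeff n h).den := by
  set ι : ℚ⟦X⟧ →+* ℚ_[p]⟦X⟧ := PowerSeries.map (algebraMap ℚ ℚ_[p]) with hι
  have hΘp : IsPadicInt (ι Θ) := by
    rw [isPadicInt_iff_coeff]; intro m
    rw [hι, coeff_map, eq_ratCast]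
    exact Padic.norm_rat_le_one (hΘ m)
  have hhp : IsPadicInt (ι h) := by
    refine isPadicInt_of_pow_three_eq hp3 hΘp (by rw [← map_pow, hh]) ?_
    rw [hι, ← coeff_zero_eq_constantCoeff, coeff_map, coeff_zero_eq_constantCoeff, hh0]; simp
  have hn := (isPadicInt_iff_coeff.mp hhp) n
  rw [hι, coeff_map, eq_ratCast] at hn
  exact not_dvd_den_of_norm_ratCast_le_one hn

end Summit.BirchSwinnertonDyer.BirchSwinnertonDyer.Theorems.ManinLocalTwoThree.KummerCubeRootBounded

end
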